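import Literature.NumberTheory.Sieve.IwaniecBilinearSieveLevels
import Literature.NumberTheory.Sieve.IwaniecBilinearSieveBilinear
import HarnessLib

/-!
# Iwaniec's bilinear linear sieve, VII: the core construction (weights, remainder, main terms)

Topic `Literature/NumberTheory/Sieve`; seventh support file for the proof of
`Literature.NumberTheory.Sieve.Iwaniec1978.lemma2_bilinearSieve` (H. Iwaniec, *A new form of the error
term in the linear sieve*, Acta Arith. 37 (1980), 307–320, Theorem 1 [IwaniecActaArith1980b]).  For a level
`D > 1` (Iwaniec's `D` of Theorem 4, our `D₄`) and `0 < ε < 1/3` we fix `η = ε⁹`, `u = D^{ε²}`,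
`w₁ = min(e^{√log D}, u)`, and the three weight systems — `μ χ^{±}_{10}` of level `D^{ε/3}` on the primes
`< w₁` (fundamental lemma), Rosser's `μ χ^{±}` (`β = 2`) of level `D^{2ε/3}` on `[w₁, u)`, and the box-truncated
Rosser weights of level `D` on `[u, z)` — composed by sign selection (`IwaniecBilinearSieveComposite.lean`).
This file PROVES, for the resulting weights `Λ^±_z` on the divisors of `P(z)`:

* the sieve inequalities `∑_{d ∣ n} Λ⁻_z(d) ≤ [n = 1] ≤ ∑_{d ∣ n} Λ⁺_z(d)` (`Core.upper_LamZ`, `Core.lower_LamZ`),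
  hence the bounds for `S(ℬ, z)` of a finite integer sequence;
* the remainder identity: `∑_{d ∣ P(z)} Λ^±_z(d) r(d)` is the sum over `l` of the bilinear forms with the
  coefficients of `IwaniecBilinearSieveBilinear.lean` (`Core.sum_LamZ_mul_eq_bilinear`), for every `r`, all
  `2 ≤ z ≤ D`, with ranges `m < D^ε M'^{1+η}`, `n < N'^{1+η}` (`M'N' = D`);
* the main-term decomposition `∑_{d ∣ P(z)} Λ_z(d) g(d) = ∑_t λ_C(t) g(t) Φ^{±(t)}` and the level-wise bounds
  of `IwaniecBilinearSieveLevels.lean` assembled into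
  `∑_d Λ⁺_z(d) g(d) ≤ V(z) (F(log D/log z) + Err⁺)` and the lower twin (`Core.mainSum_LamZ_one_le`,
  `Core.le_mainSum_LamZ_zero`) under the hypotheses of the main regime, with `Err^±` explicit in
  `ε, K, log D`; and the crude bound `|∑_d Λ_z(d) g(d)| ≤ V(z)⁻¹` (`Core.abs_mainSum_LamZ_le`).

## References

* H. Iwaniec, *A new form of the error term in the linear sieve*, Acta Arith. 37 (1980), 307–320, §§2, 4, 5.
  [IwaniecActaArith1980b]
-/

open Finset Real Filter
open scoped ArithmeticFunction.Moebius

noncomputable section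

namespace Literature.NumberTheory.Sieve

namespace Iwaniec1980b

/-- `compSel` depends on `d` only through `(d, P_in)` and `(d, P_out)`. [folklore] -/
theorem _root_.Literature.NumberTheory.Sieve.BetaSieve.compSel_congr {par : ℕ} {lam phiP phiM : ℕ → ℝ}
    {Pin Pout Pin' Pout' d : ℕ} (hin : Nat.gcd d Pin = Nat.gcd d Pin') (hout : Nat.gcd d Pout = Nat.gcd d Pout') :
    BetaSieve.compSel par lam phiP phiM Pin Pout d = BetaSieve.compSel par lam phiP phiM Pin' Pout' d := by
  rw [BetaSieve.compSel_apply, BetaSieve.compSel_apply, hin, hout]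

/-- `P(b, c) = 1` when `c ≤ b` (empty range). [folklore] -/
theorem primesProdIco_eq_one_of_le {b c : ℝ} (h : c ≤ b) : primesProdIco b c = 1 := by
  rw [primesProdIco_def]
  refine Finset.prod_eq_one fun p hp => ?_
  exfalso
  rw [Finset.mem_filter, Nat.mem_primesBelow] at hp
  have : (p : ℝ) < c := Nat.lt_ceil.mp hp.1.1
  linarith [hp.2]

/-- `P(a, b) · P(b, c) = P(a, c)` for `a ≤ b ≤ c`. [folklore] -/
theorem primesProdIco_mul {a b c : ℝ} (hab : a ≤ b) (hbc : b ≤ c) :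
    primesProdIco a b * primesProdIco b c = primesProdIco a c := by
  rw [primesProdIco_def, primesProdIco_def, primesProdIco_def]
  rw [← Finset.prod_filter_mul_prod_filter_not ((Nat.primesBelow ⌈c⌉₊).filter fun p : ℕ => a ≤ (p : ℝ))
    (fun p : ℕ => (p : ℝ) < b)]
  congr 1
  · refine Finset.prod_congr ?_ fun _ _ => rfl
    ext p
    simp only [Finset.mem_filter, Nat.mem_primesBelow, Nat.lt_ceil]
    constructor
    · rintro ⟨⟨hpb, hp⟩, hap⟩; exact ⟨⟨⟨hpb.trans_le hbc, hp⟩, hap⟩, hpb⟩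
    · rintro ⟨⟨⟨-, hp⟩, hap⟩, hpb⟩; exact ⟨⟨hpb, hp⟩, hap⟩
  · refine Finset.prod_congr ?_ fun _ _ => rfl
    ext p
    simp only [Finset.mem_filter, Nat.mem_primesBelow, Nat.lt_ceil, not_lt]
    constructor
    · rintro ⟨⟨hpc, hp⟩, hbp⟩; exact ⟨⟨⟨hpc, hp⟩, hab.trans hbp⟩, hbp⟩
    · rintro ⟨⟨⟨hpc, hp⟩, -⟩, hbp⟩; exact ⟨⟨hpc, hp⟩, hbp⟩

/-- A divisor of `P(b)` is coprime to `P(b, c)`. [folklore] -/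
theorem coprime_primesProdIco_of_dvd {e : ℕ} {b : ℝ} (he : e ∣ primesProdBelow b) (c : ℝ) :
    Nat.Coprime e (primesProdIco b c) :=
  Nat.Coprime.coprime_dvd_left he (coprime_primesProdBelow_primesProdIco b c)

/-- For `e ∣ P(y)` and `y ≤ c`: `(e, P(c, w)) = (e, P(y, w))`. [folklore] -/
theorem gcd_primesProdIco_eq_of_dvd {e : ℕ} {w y c : ℝ} (he : e ∣ primesProdBelow y) (hyc : y ≤ c) :
    Nat.gcd e (primesProdIco w c) = Nat.gcd e (primesProdIco w y) := by
  rcases le_total w y with hwy | hyw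
  · rw [← primesProdIco_mul hwy hyc, Nat.Coprime.gcd_mul_right_cancel_right]
    exact (coprime_primesProdIco_of_dvd he c).symm
  · rw [primesProdIco_eq_one_of_le hyw]
    have : Nat.Coprime e (primesProdIco w c) :=
      Nat.Coprime.coprime_dvd_right (Finset.prod_dvd_prod_of_subset _ _ _ (fun p hp => by
        rw [Finset.mem_filter] at hp ⊢; exact ⟨hp.1, hyw.trans hp.2⟩)) (coprime_primesProdIco_of_dvd he c)
    rw [Nat.gcd_one_right]; exact this

/-- For `e ∣ P(y)` and `y ≤ c`: `(e, P(c)) = (e, P(y)) = e`. [folklore] -/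
theorem gcd_primesProdBelow_eq_of_dvd {e : ℕ} {y c : ℝ} (he : e ∣ primesProdBelow y) (hyc : y ≤ c) :
    Nat.gcd e (primesProdBelow c) = Nat.gcd e (primesProdBelow y) := by
  rw [Nat.gcd_eq_left he, Nat.gcd_eq_left (he.trans (SieveSequence.primesProdBelow_dvd hyc))]

/-! ### Upper and lower sieves sandwich `V` (the probabilistic identity) -/

/-- The "probability" weights `G(n) = g(n) ∏_{p ∣ P/n} (1 − g(p))` of the divisors `n` of a squarefree `P`
satisfy `∑_{n : d ∣ n ∣ P} G(n) = g(d)` for `d ∣ P` (multiplicative `g`). [folklore] -/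
theorem sum_filter_dvd_mul_prod_eq {g : ArithmeticFunction ℝ} (hg : g.IsMultiplicative) :
    ∀ {P : ℕ}, Squarefree P → ∀ {d : ℕ}, d ∣ P →
      ∑ n ∈ P.divisors with d ∣ n, g n * ∏ p ∈ (P / n).primeFactors, (1 - g p) = g d := by
  intro P
  induction P using Nat.strong_induction_on with
  | _ P ih =>
    intro hP d hd
    by_cases h1 : P = 1
    · subst h1
      have hd1 : d = 1 := Nat.dvd_one.mp hd
      subst hd1
      simp [hg.map_one]
    -- peel the least prime `q` of `P`: `P = P' q`
    have hq := Nat.minFac_prime h1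
    set q := P.minFac with hqdef
    set P' := P / P.minFac with hP'def
    have hP'0 : P' ≠ 0 := (Nat.div_pos (Nat.minFac_le (Nat.pos_of_ne_zero hP.ne_zero)) hq.pos).ne'
    have hqP' : ¬ q ∣ P' := BetaSieve.not_minFac_dvd_div hP h1
    have hPP' : P' * q = P := BetaSieve.div_minFac_mul
    have hlt : P' < P := Nat.div_lt_self (Nat.pos_of_ne_zero hP.ne_zero) hq.one_lt
    have hP'sq : Squarefree P' := hP.squarefree_of_dvd (Nat.div_dvd_of_dvd (Nat.minFac_dvd P))
    have hcopq : ∀ n, n ∣ P' → Nat.Coprime n q := fun n hn =>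
      (Nat.Coprime.coprime_dvd_left hn ((hq.coprime_iff_not_dvd.mpr hqP').symm))
    -- split the sum over the divisors of `P' q`
    rw [← hPP']
    have key : ∀ f : ℕ → ℝ, ∑ n ∈ (P' * q).divisors with d ∣ n, f n =
        (∑ n ∈ P'.divisors with d ∣ n, f n) + ∑ n ∈ P'.divisors with d ∣ n * q, f (n * q) := by
      intro f
      rw [Finset.sum_filter, Finset.sum_filter, Finset.sum_filter, BetaSieve.sum_divisors_mul_prime hq hqP']
    rw [key]
    -- the complementary products
    have hprod1 : ∀ n ∈ P'.divisors, ∏ p ∈ (P' * q / n).primeFactors, (1 - g p) =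
        (1 - g q) * ∏ p ∈ (P' / n).primeFactors, (1 - g p) := by
      intro n hn
      have hnP' := Nat.dvd_of_mem_divisors hn
      have hn0 : n ≠ 0 := Nat.ne_of_gt (Nat.pos_of_mem_divisors hn)
      have hdiv : P' * q / n = P' / n * q := (Nat.div_mul_right_comm hnP' q).symm
      have hq' : ¬ q ∣ P' / n := fun h => hqP' (h.trans (Nat.div_dvd_of_dvd hnP'))
      have h0 : P' / n ≠ 0 := (Nat.div_pos (Nat.le_of_dvd (Nat.pos_of_ne_zero hP'0) hnP') (Nat.pos_of_ne_zero hn0)).ne'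
      rw [hdiv, BetaSieve.primeFactors_mul_prime hq h0, Finset.prod_union, Finset.prod_singleton, mul_comm]
      rw [Finset.disjoint_singleton_right]
      exact fun h => hq' (Nat.dvd_of_mem_primeFactors h)
    have hprod2 : ∀ n ∈ P'.divisors, ∏ p ∈ (P' * q / (n * q)).primeFactors, (1 - g p) =
        ∏ p ∈ (P' / n).primeFactors, (1 - g p) := by
      intro n hn
      rw [Nat.mul_div_mul_right _ _ hq.pos]
    by_cases hqd : q ∣ d
    · -- `d = d' q`: the first sum vanishes, the second is the claim for `P'`, `d'`
      obtain ⟨d', rfl⟩ : ∃ d', d = d' * q := by obtain ⟨c, hc⟩ := hqd; exact ⟨c, by rw [hc, mul_comm]⟩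
      have hd' : d' ∣ P' := by
        have := hd; rw [← hPP'] at this; exact Nat.dvd_of_mul_dvd_mul_right hq.pos this
      have hzero : ∑ n ∈ P'.divisors with d' * q ∣ n, g n * ∏ p ∈ (P' * q / n).primeFactors, (1 - g p) = 0 := by
        refine Finset.sum_eq_zero fun n hn => ?_
        exfalso
        rw [Finset.mem_filter] at hn
        exact hqP' ((dvd_mul_left q d').trans (hn.2.trans (Nat.dvd_of_mem_divisors hn.1)))
      rw [hzero, zero_add]
      have hfilt : (P'.divisors.filter fun n => d' * q ∣ n * q) = P'.divisors.filter fun n => d' ∣ n := by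
        refine Finset.filter_congr fun n _ => ?_
        exact Nat.mul_dvd_mul_iff_right hq.pos
      rw [hfilt]
      have := ih P' hlt hP'sq hd'
      rw [Finset.sum_filter] at this ⊢
      rw [hg.map_mul_of_coprime (hcopq d' hd')]
      calc ∑ n ∈ P'.divisors, (if d' ∣ n then g (n * q) * ∏ p ∈ (P' * q / (n * q)).primeFactors, (1 - g p) else 0)
          = ∑ n ∈ P'.divisors, (if d' ∣ n then g n * ∏ p ∈ (P' / n).primeFactors, (1 - g p) else 0) * g q := by
            refine Finset.sum_congr rfl fun n hn => ?_
            split_ifs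
            · rw [hprod2 n hn, hg.map_mul_of_coprime (hcopq n (Nat.dvd_of_mem_divisors hn))]; ring
            · ring
        _ = g d' * g q := by rw [← Finset.sum_mul, this]
    · -- `q ∤ d`: `d ∣ P'`; both sums are `(1 − g q) g d` and `g q g d`
      have hd' : d ∣ P' := by
        have hcop : Nat.Coprime d q := (hq.coprime_iff_not_dvd.mpr hqd).symm
        have := hd; rw [← hPP'] at this
        exact hcop.dvd_of_dvd_mul_right this
      have ih' := ih P' hlt hP'sq hd'
      rw [Finset.sum_filter] at ih'
      have hA : ∑ n ∈ P'.divisors with d ∣ n, g n * ∏ p ∈ (P' * q / n).primeFactors, (1 - g p) = (1 - g q) * g d := by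
        rw [Finset.sum_filter, ← ih', Finset.mul_sum]
        refine Finset.sum_congr rfl fun n hn => ?_
        split_ifs
        · rw [hprod1 n hn]; ring
        · ring
      have hfilt : (P'.divisors.filter fun n => d ∣ n * q) = P'.divisors.filter fun n => d ∣ n := by
        refine Finset.filter_congr fun n _ => ?_
        exact ⟨fun h => ((hq.coprime_iff_not_dvd.mpr hqd).symm).dvd_of_dvd_mul_right h, fun h => h.mul_right q⟩
      have hB : ∑ n ∈ P'.divisors with d ∣ n * q, g (n * q) * ∏ p ∈ (P' * q / (n * q)).primeFactors, (1 - g p) = g q * g d := by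
        rw [hfilt, Finset.sum_filter, ← ih', Finset.mul_sum]
        refine Finset.sum_congr rfl fun n hn => ?_
        split_ifs
        · rw [hprod2 n hn, hg.map_mul_of_coprime (hcopq n (Nat.dvd_of_mem_divisors hn))]; ring
        · ring
      rw [hA, hB]; ring

/-- **The probabilistic identity**: `∑_{d ∣ P} w(d) g(d) = ∑_{n ∣ P} G(n) ∑_{d ∣ n} w(d)` with
`G(n) = g(n) ∏_{p ∣ P/n} (1 − g(p))` (squarefree `P`, multiplicative `g`). [cite: FriedlanderIwaniecOpera2010, §6.2 Cor. 6.2] -/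
theorem sum_weights_mul_eq_sum_G {g : ArithmeticFunction ℝ} (hg : g.IsMultiplicative) {P : ℕ} (hP : Squarefree P)
    (w : ℕ → ℝ) :
    ∑ d ∈ P.divisors, w d * g d =
      ∑ n ∈ P.divisors, (g n * ∏ p ∈ (P / n).primeFactors, (1 - g p)) * ∑ d ∈ n.divisors, w d := by
  classical
  calc ∑ d ∈ P.divisors, w d * g d
      = ∑ d ∈ P.divisors, w d * ∑ n ∈ P.divisors with d ∣ n, g n * ∏ p ∈ (P / n).primeFactors, (1 - g p) := by
        refine Finset.sum_congr rfl fun d hd => ?_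
        rw [sum_filter_dvd_mul_prod_eq hg hP (Nat.dvd_of_mem_divisors hd)]
    _ = ∑ d ∈ P.divisors, ∑ n ∈ P.divisors, (if d ∣ n then w d * (g n * ∏ p ∈ (P / n).primeFactors, (1 - g p)) else 0) := by
        refine Finset.sum_congr rfl fun d _ => ?_
        rw [Finset.sum_filter, Finset.mul_sum]
        refine Finset.sum_congr rfl fun n _ => ?_
        split_ifs <;> ring
    _ = ∑ n ∈ P.divisors, ∑ d ∈ P.divisors, (if d ∣ n then w d * (g n * ∏ p ∈ (P / n).primeFactors, (1 - g p)) else 0) :=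
        Finset.sum_comm
    _ = ∑ n ∈ P.divisors, (g n * ∏ p ∈ (P / n).primeFactors, (1 - g p)) * ∑ d ∈ n.divisors, w d := by
        refine Finset.sum_congr rfl fun n hn => ?_
        rw [Finset.mul_sum, ← Finset.sum_filter]
        rw [Nat.divisors_filter_dvd_of_dvd hP.ne_zero (Nat.dvd_of_mem_divisors hn)]
        refine Finset.sum_congr rfl fun d _ => ?_; ring

/-- The weights `G(n)` are nonnegative when `0 ≤ g(p) ≤ 1` on the primes of `P`. [folklore] -/
theorem G_nonneg {g : ArithmeticFunction ℝ} (hg : g.IsMultiplicative) {P : ℕ} (hP : Squarefree P)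
    (h01 : ∀ p ∈ P.primeFactors, 0 ≤ g p ∧ g p ≤ 1) {n : ℕ} (hn : n ∈ P.divisors) :
    0 ≤ g n * ∏ p ∈ (P / n).primeFactors, (1 - g p) := by
  have hnsq := hP.squarefree_of_dvd (Nat.dvd_of_mem_divisors hn)
  refine mul_nonneg ?_ (Finset.prod_nonneg fun p hp => ?_)
  · rw [← Nat.prod_primeFactors_of_squarefree hnsq, hg.map_prod_of_subset_primeFactors _ _ Finset.Subset.rfl]
    exact Finset.prod_nonneg fun p hp => (h01 p (Nat.primeFactors_mono (Nat.dvd_of_mem_divisors hn) hP.ne_zero hp)).1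
  · exact sub_nonneg.mpr (h01 p (Nat.primeFactors_mono (Nat.div_dvd_of_dvd (Nat.dvd_of_mem_divisors hn)) hP.ne_zero hp)).2

/-- `V(P) = ∑_{n ∣ P} G(n) [n = 1]`. [folklore] -/
theorem vprod_eq_sum_G_ite {g : ArithmeticFunction ℝ} (hg : g.IsMultiplicative) {P : ℕ} (hP : P ≠ 0) :
    BetaSieve.vprod g P = ∑ n ∈ P.divisors, (g n * ∏ p ∈ (P / n).primeFactors, (1 - g p)) * (if n = 1 then (1:ℝ) else 0) := by
  have h1 : (1 : ℕ) ∈ P.divisors := Nat.one_mem_divisors.mpr hP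
  rw [Finset.sum_eq_single_of_mem 1 h1 (fun n _ hn1 => by rw [if_neg hn1, mul_zero]), if_pos rfl, mul_one,
    hg.map_one, one_mul, Nat.div_one]
  rfl

/-- **An upper sieve has main term at least `V`** (multiplicative `g`, `0 ≤ g(p) ≤ 1` on the primes of the
squarefree `P`). [cite: FriedlanderIwaniecOpera2010, §6.2 Cor. 6.2] -/
theorem vprod_le_sum_of_upper {g : ArithmeticFunction ℝ} (hg : g.IsMultiplicative) {P : ℕ} (hP : Squarefree P)
    (h01 : ∀ p ∈ P.primeFactors, 0 ≤ g p ∧ g p ≤ 1) {w : ℕ → ℝ}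
    (hw : ∀ n, n ∣ P → (if n = 1 then (1:ℝ) else 0) ≤ ∑ d ∈ n.divisors, w d) :
    BetaSieve.vprod g P ≤ ∑ d ∈ P.divisors, w d * g d := by
  rw [sum_weights_mul_eq_sum_G hg hP, vprod_eq_sum_G_ite hg hP.ne_zero]
  exact Finset.sum_le_sum fun n hn => mul_le_mul_of_nonneg_left (hw n (Nat.dvd_of_mem_divisors hn)) (G_nonneg hg hP h01 hn)

/-- **A lower sieve has main term at most `V`.** [cite: FriedlanderIwaniecOpera2010, §6.2 Cor. 6.2] -/
theorem sum_le_vprod_of_lower {g : ArithmeticFunction ℝ} (hg : g.IsMultiplicative) {P : ℕ} (hP : Squarefree P)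
    (h01 : ∀ p ∈ P.primeFactors, 0 ≤ g p ∧ g p ≤ 1) {w : ℕ → ℝ}
    (hw : ∀ n, n ∣ P → ∑ d ∈ n.divisors, w d ≤ (if n = 1 then (1:ℝ) else 0)) :
    ∑ d ∈ P.divisors, w d * g d ≤ BetaSieve.vprod g P := by
  rw [sum_weights_mul_eq_sum_G hg hP, vprod_eq_sum_G_ite hg hP.ne_zero]
  exact Finset.sum_le_sum fun n hn => mul_le_mul_of_nonneg_left (hw n (Nat.dvd_of_mem_divisors hn)) (G_nonneg hg hP h01 hn)

namespace Core

/-! ### Parameters -/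

/-- `η = ε⁹` (p. 311). [cite: IwaniecActaArith1980b, p. 311] -/
def eta (ε : ℝ) : ℝ := ε ^ 9

/-- `u = D₀ = D^{ε²}` (p. 314). [cite: IwaniecActaArith1980b, §4 p. 314] -/
def uu (D ε : ℝ) : ℝ := grid D ε (eta ε) 0

/-- `w₁ = min(e^{√(log D)}, u)`: the tiny primes `< w₁` are sieved by the fundamental lemma. [folklore] -/
def w1 (D ε : ℝ) : ℝ := min (Real.exp (Real.sqrt (Real.log D))) (uu D ε)

/-- The level `D^{ε/3}` of the sieve on the tiny primes. [folklore] -/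
def levA (D ε : ℝ) : ℝ := D ^ (ε / 3)

/-- The level `D^{2ε/3}` of Rosser's sieve on `[w₁, u)`. [folklore] -/
def levB (D ε : ℝ) : ℝ := D ^ (2 * ε / 3)

variable (D ε : ℝ)

/-- `u = D^{ε²}`. [folklore] -/
theorem uu_def : uu D ε = D ^ (ε ^ 2) := by rw [uu, grid, pow_zero, mul_one]

/-- `w₁ ≤ u`. [folklore] -/
theorem w1_le_uu : w1 D ε ≤ uu D ε := min_le_right _ _

/-- `w₁ ≤ e^{√(log D)}`. [folklore] -/
theorem w1_le_exp : w1 D ε ≤ Real.exp (Real.sqrt (Real.log D)) := min_le_left _ _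

variable {D ε}

/-- `η > 0`. [folklore] -/
theorem eta_pos (hε : 0 < ε) : 0 < eta ε := pow_pos hε 9

/-- `1 < u`. [folklore] -/
theorem one_lt_uu (hD : 1 < D) (hε : 0 < ε) : 1 < uu D ε := by
  rw [uu_def]; exact Real.one_lt_rpow hD (pow_pos hε 2)

/-- `1 < w₁`. [folklore] -/
theorem one_lt_w1 (hD : 1 < D) (hε : 0 < ε) : 1 < w1 D ε := by
  refine lt_min ?_ (one_lt_uu hD hε)
  exact Real.one_lt_exp_iff.mpr (Real.sqrt_pos.mpr (Real.log_pos hD))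

/-! ### The weights -/

/-- The weights `μ(e) χ^{±}_{10}(e)` of level `D^{ε/3}` (tiny primes). [folklore] -/
def lamA (D ε : ℝ) (par : ℕ) (e : ℕ) : ℝ := (μ e : ℝ) * BetaSieve.ind par 10 (levA D ε) e

/-- Rosser's weights `μ(e) χ^{±}(e)` (`β = 2`) of level `D^{2ε/3}` (middle primes). [folklore] -/
def lamB (D ε : ℝ) (par : ℕ) (e : ℕ) : ℝ := (μ e : ℝ) * BetaSieve.ind par 2 (levB D ε) e

/-- The small composite `φ^±`: Rosser on `[w₁, u)` with the fundamental-lemma weights inside, sign-selected.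
[cite: IwaniecActaArith1980b, §4 Lemma 4 p. 316] -/
def phi (D ε : ℝ) (par : ℕ) (e : ℕ) : ℝ :=
  if e ∣ primesProdBelow (uu D ε) then
    BetaSieve.compSel par (lamB D ε par) (lamA D ε 1) (lamA D ε 0)
      (primesProdBelow (w1 D ε)) (primesProdIco (w1 D ε) (uu D ε)) e
  else 0

section Weights

variable {D ε : ℝ} (hD : 1 < D) (hε : 0 < ε)

/-- The box weights `μ(t) χ̃^±(t)` of level `D` on the large primes. [cite: IwaniecActaArith1980b, §4 p. 315] -/
def lamC (par : ℕ) (t : ℕ) : ℝ :=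
  (μ t : ℝ) * BetaSieve.indC par (fun t => condK (D := D) (ε := ε) (η := eta ε) (pat hD hε (eta_pos hε) t)) t

/-- **The weights `Λ^±_z` on the divisors of `P(z)`**: the box weights with the small composite inside,
sign-selected; the small moduli are truncated at `min(z, u)`. [cite: IwaniecActaArith1980b, §4 (17)–(18), (23)–(24)] -/
def LamZ (par : ℕ) (z : ℝ) : ℕ → ℝ :=
  BetaSieve.compSel par (lamC hD hε par) (phi D ε 1) (phi D ε 0)
    (primesProdBelow (min z (uu D ε))) (primesProdIco (uu D ε) z)

include hD hε

omit hD hε in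
/-- `|λ_A| ≤ 1`. [folklore] -/
theorem abs_lamA_le_one (par : ℕ) (e : ℕ) : |lamA D ε par e| ≤ 1 := by
  rw [lamA, abs_mul]
  have hμ : |(μ e : ℝ)| ≤ 1 := by exact_mod_cast ArithmeticFunction.abs_moebius_le_one
  exact mul_le_one₀ hμ (abs_nonneg _) (BetaSieve.abs_ind_le_one e)

omit hD hε in
/-- `|λ_B| ≤ 1`. [folklore] -/
theorem abs_lamB_le_one (par : ℕ) (e : ℕ) : |lamB D ε par e| ≤ 1 := by
  rw [lamB, abs_mul]
  have hμ : |(μ e : ℝ)| ≤ 1 := by exact_mod_cast ArithmeticFunction.abs_moebius_le_one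
  exact mul_le_one₀ hμ (abs_nonneg _) (BetaSieve.abs_ind_le_one e)

omit hD hε in
/-- `|φ^±| ≤ 1`. [folklore] -/
theorem abs_phi_le_one (par : ℕ) (e : ℕ) : |phi D ε par e| ≤ 1 := by
  unfold phi; split_ifs
  · exact BetaSieve.abs_compSel_le_one (abs_lamB_le_one par) (abs_lamA_le_one 1) (abs_lamA_le_one 0) par e
  · simp

/-- `|λ_C| ≤ 1`. [folklore] -/
theorem abs_lamC_le_one (par : ℕ) (t : ℕ) : |lamC hD hε par t| ≤ 1 :=
  BetaSieve.abs_moebius_mul_indC_le_one t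

/-- `|Λ_z| ≤ 1`. [folklore] -/
theorem abs_LamZ_le_one (par : ℕ) (z : ℝ) (d : ℕ) : |LamZ hD hε par z d| ≤ 1 :=
  BetaSieve.abs_compSel_le_one (abs_lamC_le_one hD hε par) (abs_phi_le_one 1) (abs_phi_le_one 0) par d

/-! ### The sieve inequalities -/

omit hD hε in
/-- `φ⁺` is an upper and `φ⁻` a lower sieve on the divisors of `P(y)` for every `y ≤ u`. [folklore] -/
theorem upper_lower_phi {y : ℝ} (hyu : y ≤ uu D ε) {a : ℕ} (ha : a ∣ primesProdBelow y) :
    ((if a = 1 then (1:ℝ) else 0) ≤ ∑ e ∈ a.divisors, phi D ε 1 e) ∧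
      (∑ e ∈ a.divisors, phi D ε 0 e ≤ if a = 1 then (1:ℝ) else 0) := by
  -- truncate the moduli at `y`: `P(y) = P(min y w₁) · P(y, w₁)`
  set w := w1 D ε with hw
  set Pin := primesProdBelow (min y w) with hPin
  set Pout := primesProdIco w y with hPout
  have hyw : min y w ≤ w := min_le_right _ _
  have hPy : primesProdBelow y = Pin * Pout := by
    rw [hPin, hPout]
    rcases le_total y w with hyw' | hwy
    · rw [min_eq_left hyw']
      have : primesProdIco w y = 1 := by
        rw [primesProdIco_def]
        refine Finset.prod_eq_one fun p hp => ?_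
        exfalso
        rw [Finset.mem_filter, Nat.mem_primesBelow] at hp
        have : (p : ℝ) < y := Nat.lt_ceil.mp hp.1.1
        linarith [hp.2]
      rw [this, mul_one]
    · rw [min_eq_right hwy, primesProdBelow_mul_primesProdIco hwy]
  have hcop : Nat.Coprime Pin Pout := by
    rw [hPin, hPout]
    exact Nat.Coprime.coprime_dvd_left (SieveSequence.primesProdBelow_dvd hyw)
      (coprime_primesProdBelow_primesProdIco w y)
  -- `φ` agrees on the divisors of `a` with the composite over the truncated moduli
  have hcongr : ∀ par, ∀ e ∈ a.divisors, phi D ε par e =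
      BetaSieve.compSel par (lamB D ε par) (lamA D ε 1) (lamA D ε 0) Pin Pout e := by
    intro par e he
    have hey : e ∣ primesProdBelow y := (Nat.dvd_of_mem_divisors he).trans ha
    have heu : e ∣ primesProdBelow (uu D ε) := hey.trans (SieveSequence.primesProdBelow_dvd hyu)
    unfold phi
    rw [if_pos heu]
    refine BetaSieve.compSel_congr ?_ ?_
    · -- `(e, P(w₁)) = (e, P(min y w₁))`
      rw [hPin]
      rcases le_total y w with hyw' | hwy
      · rw [min_eq_left hyw', gcd_primesProdBelow_eq_of_dvd hey hyw']
      · rw [min_eq_right hwy]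
    · exact gcd_primesProdIco_eq_of_dvd hey hyu
  have hPin_sq : Squarefree Pin := squarefree_primesProdBelow _
  have hPout_sq : Squarefree Pout := squarefree_primesProdIco _ _
  have hlamA1 : ∀ b, b ∣ Pin → (if b = 1 then (1:ℝ) else 0) ≤ ∑ t ∈ b.divisors, lamA D ε 1 t := fun b hb =>
    BetaSieve.upper_sieve (hPin_sq.squarefree_of_dvd hb)
  have hlamA0 : ∀ b, b ∣ Pin → ∑ t ∈ b.divisors, lamA D ε 0 t ≤ (if b = 1 then (1:ℝ) else 0) := fun b hb =>
    BetaSieve.lower_sieve (hPin_sq.squarefree_of_dvd hb)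
  have hlamB1 : ∀ b, b ∣ Pout → (if b = 1 then (1:ℝ) else 0) ≤ ∑ t ∈ b.divisors, lamB D ε 1 t := fun b hb =>
    BetaSieve.upper_sieve (hPout_sq.squarefree_of_dvd hb)
  have hlamB0 : ∀ b, b ∣ Pout → ∑ t ∈ b.divisors, lamB D ε 0 t ≤ (if b = 1 then (1:ℝ) else 0) := fun b hb =>
    BetaSieve.lower_sieve (hPout_sq.squarefree_of_dvd hb)
  have ha' : a ∣ Pin * Pout := hPy ▸ ha
  constructor
  · rw [Finset.sum_congr rfl (hcongr 1)]
    exact BetaSieve.upper_compSel hcop hlamB1 hlamA1 hlamA0 ha'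
  · rw [Finset.sum_congr rfl (hcongr 0)]
    exact BetaSieve.lower_compSel hcop hlamB0 hlamA1 hlamA0 ha'

omit hD hε in
/-- `P(z) = P(min z u) · P(z, u)`. [folklore] -/
theorem primesProdBelow_eq_min_mul (z : ℝ) :
    primesProdBelow z = primesProdBelow (min z (uu D ε)) * primesProdIco (uu D ε) z := by
  rcases le_total z (uu D ε) with hzu | huz
  · rw [min_eq_left hzu, primesProdIco_eq_one_of_le hzu, mul_one]
  · rw [min_eq_right huz, primesProdBelow_mul_primesProdIco huz]

omit hD hε in
/-- `P(min z u)` and `P(z, u)` are coprime. [folklore] -/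
theorem coprime_min_Ico (z : ℝ) :
    Nat.Coprime (primesProdBelow (min z (uu D ε))) (primesProdIco (uu D ε) z) :=
  Nat.Coprime.coprime_dvd_left (SieveSequence.primesProdBelow_dvd (min_le_right _ _))
    (coprime_primesProdBelow_primesProdIco _ _)

/-- **`Λ⁺_z` is an upper sieve and `Λ⁻_z` a lower sieve on the divisors of `P(z)`.**
[cite: IwaniecActaArith1980b, §4 (15)–(18) with Lemma 4] -/
theorem upper_lower_LamZ (z : ℝ) {n : ℕ} (hn : n ∣ primesProdBelow z) :
    ((if n = 1 then (1:ℝ) else 0) ≤ ∑ d ∈ n.divisors, LamZ hD hε 1 z d) ∧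
      (∑ d ∈ n.divisors, LamZ hD hε 0 z d ≤ if n = 1 then (1:ℝ) else 0) := by
  set Pin := primesProdBelow (min z (uu D ε)) with hPin
  set Pout := primesProdIco (uu D ε) z with hPout
  have hcop : Nat.Coprime Pin Pout := coprime_min_Ico z
  have hn' : n ∣ Pin * Pout := by rw [hPin, hPout, ← primesProdBelow_eq_min_mul]; exact hn
  have hPout_sq : Squarefree Pout := squarefree_primesProdIco _ _
  have hC1 : ∀ b, b ∣ Pout → (if b = 1 then (1:ℝ) else 0) ≤ ∑ t ∈ b.divisors, lamC hD hε 1 t := fun b hb =>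
    BetaSieve.upper_sieveC (hPout_sq.squarefree_of_dvd hb)
  have hC0 : ∀ b, b ∣ Pout → ∑ t ∈ b.divisors, lamC hD hε 0 t ≤ (if b = 1 then (1:ℝ) else 0) := fun b hb =>
    BetaSieve.lower_sieveC (hPout_sq.squarefree_of_dvd hb)
  have hP1 : ∀ a, a ∣ Pin → (if a = 1 then (1:ℝ) else 0) ≤ ∑ e ∈ a.divisors, phi D ε 1 e := fun a ha =>
    (upper_lower_phi (min_le_right _ _) ha).1
  have hP0 : ∀ a, a ∣ Pin → ∑ e ∈ a.divisors, phi D ε 0 e ≤ (if a = 1 then (1:ℝ) else 0) := fun a ha =>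
    (upper_lower_phi (min_le_right _ _) ha).2
  exact ⟨BetaSieve.upper_compSel hcop hC1 hP1 hP0 hn', BetaSieve.lower_compSel hcop hC0 hP1 hP0 hn'⟩

/-- **The sieve bounds for a finite sequence of integers**:
`∑_{d ∣ P(z)} Λ⁻_z(d) |ℬ_d| ≤ #{b ∈ ℬ : (b, P(z)) = 1} ≤ ∑_{d ∣ P(z)} Λ⁺_z(d) |ℬ_d|`.
[cite: IwaniecActaArith1980b, §4 (15)–(16), (23)–(24)] -/
theorem sieve_bounds_LamZ (z : ℝ) (B : Multiset ℤ) :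
    (((B.filter fun b : ℤ => Int.gcd b (primesProdBelow z) = 1).card : ℝ) ≤
        ∑ d ∈ (primesProdBelow z).divisors, LamZ hD hε 1 z d * ((B.filter fun b : ℤ => (d : ℤ) ∣ b).card : ℝ)) ∧
      (∑ d ∈ (primesProdBelow z).divisors, LamZ hD hε 0 z d * ((B.filter fun b : ℤ => (d : ℤ) ∣ b).card : ℝ) ≤
        ((B.filter fun b : ℤ => Int.gcd b (primesProdBelow z) = 1).card : ℝ)) :=
  ⟨BetaSieve.card_filter_gcd_le_sum (primesProdBelow_ne_zero z) (fun _ hn => (upper_lower_LamZ hD hε z hn).1) B,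
    BetaSieve.sum_le_card_filter_gcd (primesProdBelow_ne_zero z) (fun _ hn => (upper_lower_LamZ hD hε z hn).2) B⟩

/-! ### Support of the small composite -/

/-- `φ^±(e) ≠ 0` forces `e < D^ε` (`e ∣ P(u)`, `e = e_A e_B` with `e_A < D^{ε/3}`, `e_B < D^{2ε/3}`; here
`w₁ ≤ u = D^{ε²} ≤ D^{ε/3}` uses `ε ≤ 1/3`). [cite: IwaniecActaArith1980b, §4 Lemma 4 (20)] -/
theorem lt_of_phi_ne_zero (hε3 : ε ≤ 1 / 3) (par : ℕ) {e : ℕ} (he : phi D ε par e ≠ 0) : (e : ℝ) < D ^ ε := by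
  have hD0 : (0:ℝ) < D := by linarith
  unfold phi at he
  split_ifs at he with heu
  swap; · exact absurd rfl he
  set w := w1 D ε
  set u := uu D ε
  have hwu : w ≤ u := w1_le_uu D ε
  have heq : e = Nat.gcd e (primesProdBelow w) * Nat.gcd e (primesProdIco w u) := by
    refine BetaSieve.eq_gcd_mul_gcd_of_dvd (coprime_primesProdBelow_primesProdIco w u) ?_
    rwa [primesProdBelow_mul_primesProdIco hwu]
  set eA := Nat.gcd e (primesProdBelow w) with heA
  set eB := Nat.gcd e (primesProdIco w u) with heB
  rw [BetaSieve.compSel_apply] at he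
  have hB : lamB D ε par eB ≠ 0 := left_ne_zero_of_mul he
  have hA : BetaSieve.innerSel par (lamA D ε 1) (lamA D ε 0) (lamB D ε par eB) eA ≠ 0 := right_ne_zero_of_mul he
  -- levels
  have hu_le_A : u ≤ levA D ε := by
    rw [show u = D ^ (ε ^ 2) from uu_def D ε, levA]
    exact Real.rpow_le_rpow_of_exponent_le hD.le (by nlinarith)
  have hu_le_B : u ≤ levB D ε := by
    rw [show u = D ^ (ε ^ 2) from uu_def D ε, levB]
    exact Real.rpow_le_rpow_of_exponent_le hD.le (by nlinarith)
  have h1A : 1 < levA D ε := lt_of_lt_of_le (one_lt_uu hD hε) hu_le_A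
  have h1B : 1 < levB D ε := lt_of_lt_of_le (one_lt_uu hD hε) hu_le_B
  -- `e_B < D^{2ε/3}`
  have hBsq : Squarefree eB := (squarefree_primesProdIco w u).squarefree_of_dvd (Nat.gcd_dvd_right _ _)
  have hBprimes : ∀ p ∈ eB.primeFactors, (p : ℝ) < u := fun p hp =>
    ((dvd_primesProdIco_iff (Nat.prime_of_mem_primeFactors hp) w u).mp
      ((Nat.dvd_of_mem_primeFactors hp).trans (Nat.gcd_dvd_right _ _))).2
  have hBlt : (eB : ℝ) < levB D ε := by
    have hind : BetaSieve.ind par 2 (levB D ε) eB ≠ 0 := by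
      intro h0; apply hB; rw [lamB, h0, mul_zero]
    have hpred : BetaSieve.pred par 2 (levB D ε) eB := by
      by_contra h; exact hind (BetaSieve.ind_of_not_pred h)
    exact BetaSieve.lt_level_of_pred_of_one_le (by norm_num) h1B hu_le_B hBsq hBprimes hpred
  -- `e_A < D^{ε/3}`
  have hAsq : Squarefree eA := (squarefree_primesProdBelow w).squarefree_of_dvd (Nat.gcd_dvd_right _ _)
  have hAprimes : ∀ p ∈ eA.primeFactors, (p : ℝ) < u := fun p hp =>
    lt_of_lt_of_le ((dvd_primesProdBelow_iff (Nat.prime_of_mem_primeFactors hp) w).mp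
      ((Nat.dvd_of_mem_primeFactors hp).trans (Nat.gcd_dvd_right _ _))) hwu
  have hAlt : (eA : ℝ) < levA D ε := by
    unfold BetaSieve.innerSel at hA
    split_ifs at hA with hs
    · have hind : BetaSieve.ind 1 10 (levA D ε) eA ≠ 0 := by
        intro h0; apply hA; rw [lamA, h0, mul_zero]
      have hpred : BetaSieve.pred 1 10 (levA D ε) eA := by
        by_contra h; exact hind (BetaSieve.ind_of_not_pred h)
      exact BetaSieve.lt_level_of_pred_of_one_le (by norm_num) h1A hu_le_A hAsq hAprimes hpred
    · have hind : BetaSieve.ind 0 10 (levA D ε) eA ≠ 0 := by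
        intro h0; apply hA; rw [lamA, h0, mul_zero]
      have hpred : BetaSieve.pred 0 10 (levA D ε) eA := by
        by_contra h; exact hind (BetaSieve.ind_of_not_pred h)
      exact BetaSieve.lt_level_of_pred_of_one_le (by norm_num) h1A hu_le_A hAsq hAprimes hpred
  -- multiply
  have hA0 : (0:ℝ) ≤ eA := Nat.cast_nonneg _
  have hB1 : (1:ℝ) ≤ eB := by
    have : eB ≠ 0 := hBsq.ne_zero
    exact_mod_cast Nat.one_le_iff_ne_zero.mpr this
  rw [heq, Nat.cast_mul]
  calc (eA : ℝ) * eB < levA D ε * levB D ε := mul_lt_mul'' hAlt hBlt hA0 (by linarith)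
    _ = D ^ ε := by rw [levA, levB, ← Real.rpow_add hD0]; ring_nf

/-! ### The signs on patterns and the coefficient families -/

open Classical in
/-- The sign `λ_k = (−1)^{|k|} [k admissible (and, for the lower sieve, all boxes ≤ j₀)]`.
[cite: IwaniecActaArith1980b, (17)–(18) p. 315] -/
def Lamk (par j₀ : ℕ) (k : Multiset ℕ) : ℝ :=
  (-1 : ℝ) ^ Multiset.card k *
    (if AdmC (D := D) (ε := ε) (η := eta ε) par k ∧ (par % 2 = 0 → ∀ j ∈ k, j ≤ j₀) then 1 else 0)

omit hD hε in
/-- `|λ_k| ≤ 1`. [folklore] -/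
theorem abs_Lamk_le_one (par j₀ : ℕ) (k : Multiset ℕ) : |Lamk (D := D) (ε := ε) par j₀ k| ≤ 1 := by
  unfold Lamk; rw [abs_mul, abs_pow, abs_neg, abs_one, one_pow, one_mul]; split_ifs <;> simp

/-- The number `R = ⌊ε⁻²⌋ + 1` bounding the cardinality of the patterns. [folklore] -/
def Rnat (ε : ℝ) : ℕ := ⌊ε⁻¹ ^ 2⌋₊ + 1

/-- The number of boxes `J = boxIdx ⌈D⌉ + 1`. [folklore] -/
def Jnat : ℕ := boxIdx hD hε (eta_pos hε) ⌈D⌉₊ + 1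

/-- The universe of patterns. [folklore] -/
def Univ : Finset (Multiset ℕ) := patternsLe (Jnat hD hε) (Rnat ε)

/-- **The `m`-coefficients** of the construction (upper: `par = 1`; lower: `par = 0` with the box cut `j₀`).
[cite: IwaniecActaArith1980b, (9) p. 309] -/
def cA (par j₀ : ℕ) (Mb : ℝ) (l m : ℕ) : ℝ :=
  coefA hD hε (eta_pos hε) (primesProdBelow (uu D ε)) par (phi D ε 1) (phi D ε 0)
    (Lamk (D := D) (ε := ε) par j₀) Mb (Univ hD hε) l m

/-- **The `n`-coefficients** of the construction. [cite: IwaniecActaArith1980b, (9) p. 309] -/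
def cB (Mb : ℝ) (l n : ℕ) : ℝ :=
  coefB hD hε (eta_pos hε) (primesProdBelow (uu D ε)) Mb (Univ hD hε) l n

/-- `|a_{m,l}| ≤ 1`. [cite: IwaniecActaArith1980b, Theorem 1] -/
theorem abs_cA_le_one (par j₀ : ℕ) (Mb : ℝ) (l m : ℕ) : |cA hD hε par j₀ Mb l m| ≤ 1 :=
  abs_coefA_le_one hD hε (eta_pos hε) (abs_Lamk_le_one par j₀) (abs_phi_le_one 1) (abs_phi_le_one 0) l m

/-- `|b_{n,l}| ≤ 1`. [cite: IwaniecActaArith1980b, Theorem 1] -/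
theorem abs_cB_le_one (Mb : ℝ) (l n : ℕ) : |cB hD hε Mb l n| ≤ 1 :=
  abs_coefB_le_one hD hε (eta_pos hε) l n

/-- The box weight on a divisor of `P(z, u)` is the sign of its pattern (for the lower sieve, when
`z ≤ Δ = D_{j₀+1}`). [folklore] -/
theorem lamC_eq_Lamk (par j₀ : ℕ) {z : ℝ} (hzΔ : par % 2 = 0 → z ≤ grid D ε (eta ε) (j₀ + 1))
    {t : ℕ} (ht : t ∣ primesProdIco (uu D ε) z) :
    lamC hD hε par t = Lamk (D := D) (ε := ε) par j₀ (pat hD hε (eta_pos hε) t) := by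
  have htsq : Squarefree t := (squarefree_primesProdIco _ _).squarefree_of_dvd ht
  unfold lamC Lamk
  rw [BetaSieve.moebius_of_squarefree htsq, card_pat]
  congr 1
  have hextra : par % 2 = 0 → ∀ j ∈ pat hD hε (eta_pos hε) t, j ≤ j₀ := by
    intro hpar j hj
    obtain ⟨p, hp, rfl⟩ := (mem_pat_iff hD hε (eta_pos hε)).mp hj
    have hpz : (p : ℝ) < z := ((dvd_primesProdIco_iff (Nat.prime_of_mem_primeFactors hp) _ z).mp
      (Nat.primeFactors_mono ht (squarefree_primesProdIco _ _).ne_zero hp |> Nat.dvd_of_mem_primeFactors)).2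
    exact boxIdx_le_of_lt hD hε (eta_pos hε) (hpz.trans_le (hzΔ hpar))
  by_cases h : BetaSieve.predC par (fun t => condK (D := D) (ε := ε) (η := eta ε) (pat hD hε (eta_pos hε) t)) t
  · rw [BetaSieve.indC_of_predC h, if_pos ⟨(predC_condK_iff_admC hD hε (eta_pos hε) par htsq).mp h, hextra⟩]
  · rw [BetaSieve.indC_of_not_predC h, if_neg]
    exact fun h' => h ((predC_condK_iff_admC hD hε (eta_pos hε) par htsq).mpr h'.1)

/-! ### The remainder identity -/

omit hD hε in
/-- For `m ∣ P(z)`: `(m, P(u)) = (m, P(min z u))`. [folklore] -/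
theorem gcd_uu_eq_gcd_min {m : ℕ} {z : ℝ} (hm : m ∣ primesProdBelow z) :
    Nat.gcd m (primesProdBelow (uu D ε)) = Nat.gcd m (primesProdBelow (min z (uu D ε))) := by
  rcases le_total z (uu D ε) with hzu | huz
  · rw [min_eq_left hzu, gcd_primesProdBelow_eq_of_dvd hm hzu]
  · rw [min_eq_right huz]

/-- **The remainder of `Λ^±_z` is the sum of the bilinear forms** with the coefficients `cA`, `cB`
(independent of `z`, of the sequence and of the density): for `z ≤ D` (and `z ≤ D_{j₀+1}` for the lower
sieve), `M', N' ≥ 1` with `M'N' = D`, ranges `A ≥ D^ε M'^{1+η}`, `B ≥ N'^{1+η}`, `B > 1`, `L ≥ #U`, and every `r`,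
`∑_{d ∣ P(z)} Λ_z(d) r(d) = ∑_{l<L} ∑_{1≤m<A} ∑_{1≤n<B} [mn ∣ P(z)] a_{m,l} b_{n,l} r(mn)`.
[cite: IwaniecActaArith1980b, (9) p. 309, p. 312 and (23)–(24) p. 316] -/
theorem sum_LamZ_mul_eq_bilinear (hε3 : ε ≤ 1 / 3) (par j₀ : ℕ)
    (hΔ : grid D ε (eta ε) (j₀ + 1) ^ 2 ≤ D)
    {Mb Nb : ℝ} (hMb : 1 ≤ Mb) (hNb : 1 ≤ Nb) (hMN : Mb * Nb = D)
    {A B : ℝ} (hA : D ^ ε * Mb ^ (1 + eta ε) ≤ A) (hB : Nb ^ (1 + eta ε) ≤ B) (hB1 : 1 < B)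
    {L : ℕ} (hL : (Univ hD hε).card ≤ L)
    {z : ℝ} (hz : z ≤ D) (hzΔ : par % 2 = 0 → z ≤ grid D ε (eta ε) (j₀ + 1)) (r : ℕ → ℝ) :
    ∑ d ∈ (primesProdBelow z).divisors, LamZ hD hε par z d * r d =
      ∑ l ∈ Finset.range L, ∑ m ∈ Finset.Ico 1 ⌈A⌉₊, ∑ n ∈ Finset.Ico 1 ⌈B⌉₊,
        (if m * n ∣ primesProdBelow z then cA hD hε par j₀ Mb l m * cB hD hε Mb l n * r (m * n) else 0) := by
  have hη := eta_pos hε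
  set u := uu D ε with hu
  set Ps := primesProdBelow (min z u) with hPs
  set Pr := primesProdIco u z with hPr
  have hPz : primesProdBelow z = Ps * Pr := primesProdBelow_eq_min_mul z
  have hcop : Nat.Coprime Ps Pr := coprime_min_Ico z
  have hPs_sq : Squarefree Ps := squarefree_primesProdBelow _
  have hPr_sq : Squarefree Pr := squarefree_primesProdIco _ _
  -- Step 1: the coefficients may be taken with the truncated small modulus
  have hstep1 : ∀ l, ∀ m ∈ Finset.Ico 1 ⌈A⌉₊, ∀ n ∈ Finset.Ico 1 ⌈B⌉₊,
      (if m * n ∣ primesProdBelow z then cA hD hε par j₀ Mb l m * cB hD hε Mb l n * r (m * n) else 0) =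
      (if m * n ∣ Ps * Pr then
        coefA hD hε hη Ps par (phi D ε 1) (phi D ε 0) (Lamk (D := D) (ε := ε) par j₀) Mb (Univ hD hε) l m *
          coefB hD hε hη Ps Mb (Univ hD hε) l n * r (m * n) else 0) := by
    intro l m _ n _
    rw [← hPz]
    split_ifs with hmn
    · have hm : m ∣ primesProdBelow z := (dvd_mul_right m n).trans hmn
      have hn : n ∣ primesProdBelow z := (dvd_mul_left n m).trans hmn
      have hgm := gcd_uu_eq_gcd_min (D := D) (ε := ε) hm
      have hgn := gcd_uu_eq_gcd_min (D := D) (ε := ε) hn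
      unfold cA cB coefA coefB aCoef bCoef
      simp only [hgm, hgn]
      rfl
    · rfl
  rw [Finset.sum_congr rfl fun l _ => Finset.sum_congr rfl fun m hm => Finset.sum_congr rfl fun n hn =>
    hstep1 l m hm n hn]
  -- Step 2: the abstract assembly
  have hlam : ∀ t, t ∣ Pr → lamC hD hε par t = Lamk (D := D) (ε := ε) par j₀ (pat hD hε hη t) :=
    fun t ht => lamC_eq_Lamk hD hε par j₀ hzΔ ht
  have hU : ∀ t, t ∣ Pr → lamC hD hε par t ≠ 0 → pat hD hε hη t ∈ Univ hD hε := by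
    intro t ht hne
    have htsq : Squarefree t := hPr_sq.squarefree_of_dvd ht
    have hpred : BetaSieve.predC par (fun t => condK (D := D) (ε := ε) (η := eta ε) (pat hD hε hη t)) t := by
      by_contra h; apply hne; rw [lamC, BetaSieve.indC_of_not_predC h, mul_zero]
    have hprimes : ∀ p ∈ t.primeFactors, u ≤ (p : ℝ) ∧ (p : ℝ) < z := fun p hp =>
      (dvd_primesProdIco_iff (Nat.prime_of_mem_primeFactors hp) u z).mp
        ((Nat.dvd_of_mem_primeFactors hp).trans ht)
    have htD : (t : ℝ) < D :=
      lt_of_predC_condK hD hε hη par htsq hz (fun p hp => (hprimes p hp).2) hpred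
    refine pat_mem_patternsLe hD hε hη htsq (fun p hp => (hprimes p hp).1) htD (fun p hp => ?_) ?_
    · have : (p : ℝ) ≤ ⌈D⌉₊ := ((hprimes p hp).2.le.trans hz).trans (Nat.le_ceil D)
      exact_mod_cast this
    · rw [Rnat]; push_cast; exact (Nat.lt_floor_add_one _).le
  have hHyp : ∀ k ∈ Univ hD hε, Lamk (D := D) (ε := ε) par j₀ k ≠ 0 → HypL1 (D := D) (ε := ε) (η := eta ε) k := by
    intro k _ hne
    unfold Lamk at hne
    have hc : AdmC (D := D) (ε := ε) (η := eta ε) par k ∧ (par % 2 = 0 → ∀ j ∈ k, j ≤ j₀) := by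
      by_contra h; apply hne; rw [if_neg h, mul_zero]
    refine hypL1_of_admC hD.le hη.le par hc.1 fun hpar j hj => ?_
    have h1 : grid D ε (eta ε) j ≤ grid D ε (eta ε) (j₀ + 1) := grid_mono hD.le hη.le (Nat.le_succ_of_le (hc.2 hpar j hj))
    have h0 : 0 ≤ grid D ε (eta ε) j := (grid_pos (by linarith) _).le
    nlinarith
  have hres := sum_bilinear_eq_sum_compSel hD hε hη (par := par) hcop hPs_sq hPr_sq hlam hU hHyp hMb hNb hMN
    (fun e he => lt_of_phi_ne_zero hD hε hε3 1 he) (fun e he => lt_of_phi_ne_zero hD hε hε3 0 he) hA hB hB1 hL r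
  rw [hres, hPz]
  rfl

/-! ### The level quantities and the structural main-term inequalities -/

section MainTerm

variable {g : ArithmeticFunction ℝ} (hg : g.IsMultiplicative) (h01 : ∀ p : ℕ, p.Prime → 0 ≤ g p ∧ g p < 1)

/-- `z' = min(z, u)`. [folklore] -/
def zS (z : ℝ) : ℝ := min z (uu D ε)

/-- `z'' = min(z, w₁)`. [folklore] -/
def zT (z : ℝ) : ℝ := min z (w1 D ε)

/-- `Φ^±(z') = ∑_{e ∣ P(z')} φ^±(e) g(e)`, the main term of the small composite. [cite: IwaniecActaArith1980b, (22), (25)–(26)] -/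
def PhiS (g : ArithmeticFunction ℝ) (par : ℕ) (z : ℝ) : ℝ :=
  ∑ e ∈ (primesProdBelow (zS (D := D) (ε := ε) z)).divisors, phi D ε par e * g e

/-- `M_C^±(z) = ∑_{t ∣ P(z,u)} λ_C^±(t) g(t)`, the main term of the box weights (`= 1` for `z ≤ u`).
[cite: IwaniecActaArith1980b, §5 (29) (L^±)] -/
def MC (g : ArithmeticFunction ℝ) (par : ℕ) (z : ℝ) : ℝ :=
  ∑ t ∈ (primesProdIco (uu D ε) z).divisors, lamC hD hε par t * g t

/-- `W_C(z) = ∑_{t ∣ P(z,u)} g(t)` (`≤ V(u)/V(z)`). [cite: IwaniecActaArith1980b, §5 p. 317] -/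
def WC (g : ArithmeticFunction ℝ) (z : ℝ) : ℝ := ∑ t ∈ (primesProdIco (uu D ε) z).divisors, g t

/-- `Φ_A^±(z'') = ∑_{e ∣ P(z'')} μ(e) χ^{±}_{10}(e) g(e)`, the tiny level. [folklore] -/
def PhiA (g : ArithmeticFunction ℝ) (par : ℕ) (z : ℝ) : ℝ :=
  BetaSieve.mainSum par g 10 (levA D ε) (primesProdBelow (zT (D := D) (ε := ε) z))

/-- `G_B^±(z') = ∑_{t ∣ P(z', w₁)} μ(t) χ^{±}(t) g(t)`, the middle level (`= 1` for `z ≤ w₁`). [folklore] -/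
def GB (g : ArithmeticFunction ℝ) (par : ℕ) (z : ℝ) : ℝ :=
  BetaSieve.mainSum par g 2 (levB D ε) (primesProdIco (w1 D ε) (zS (D := D) (ε := ε) z))

/-- `W_B(z') = ∑_{t ∣ P(z', w₁)} g(t)` (`≤ V(w₁)/V(z')`). [folklore] -/
def WB (g : ArithmeticFunction ℝ) (z : ℝ) : ℝ := ∑ t ∈ (primesProdIco (w1 D ε) (zS (D := D) (ε := ε) z)).divisors, g t

omit hD hε in
/-- `z'' = min(z', w₁)`. [folklore] -/
theorem zT_eq_min_zS (z : ℝ) : zT (D := D) (ε := ε) z = min (zS (D := D) (ε := ε) z) (w1 D ε) := by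
  rw [zT, zS, min_assoc, min_eq_right (w1_le_uu D ε)]

omit hD hε in
/-- `z' ≤ u`. [folklore] -/
theorem zS_le_uu (z : ℝ) : zS (D := D) (ε := ε) z ≤ uu D ε := min_le_right _ _

omit hD hε in
/-- `z'' ≤ w₁`. [folklore] -/
theorem zT_le_w1 (z : ℝ) : zT (D := D) (ε := ε) z ≤ w1 D ε := min_le_right _ _

include hg h01

omit hD hε hg in
/-- `0 ≤ g(d)` for squarefree `d` — on the divisors of any squarefree `P`. [folklore] -/
theorem g_nonneg_of_dvd {P : ℕ} (hP : Squarefree P) (hg : g.IsMultiplicative) {d : ℕ} (hd : d ∈ P.divisors) : 0 ≤ g d := by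
  have hdsq := hP.squarefree_of_dvd (Nat.dvd_of_mem_divisors hd)
  rw [← Nat.prod_primeFactors_of_squarefree hdsq, hg.map_prod_of_subset_primeFactors _ _ Finset.Subset.rfl]
  exact Finset.prod_nonneg fun p hp => (h01 p (Nat.prime_of_mem_primeFactors hp)).1

omit hD hε hg in
/-- `0 ≤ g(p) ≤ 1` on the prime factors of any `P`. [folklore] -/
theorem h01_of_primeFactors (P : ℕ) : ∀ p ∈ P.primeFactors, 0 ≤ g p ∧ g p ≤ 1 := fun p hp =>
  ⟨(h01 p (Nat.prime_of_mem_primeFactors hp)).1, (h01 p (Nat.prime_of_mem_primeFactors hp)).2.le⟩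

/-- **The sandwiches**: `Φ⁻(z') ≤ V(z') ≤ Φ⁺(z')`, `M_C⁻ ≤ V(z,u) ≤ M_C⁺`, `Φ_A⁻ ≤ V(z'') ≤ Φ_A⁺`,
`G_B⁻ ≤ V(z',w₁) ≤ G_B⁺`. [cite: FriedlanderIwaniecOpera2010, §6.2 Cor. 6.2] -/
theorem sandwiches (z : ℝ) :
    (PhiS (D := D) (ε := ε) g 0 z ≤ BetaSieve.vprod g (primesProdBelow (zS (D := D) (ε := ε) z)) ∧
      BetaSieve.vprod g (primesProdBelow (zS (D := D) (ε := ε) z)) ≤ PhiS (D := D) (ε := ε) g 1 z) ∧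
    (MC hD hε g 0 z ≤ BetaSieve.vprod g (primesProdIco (uu D ε) z) ∧
      BetaSieve.vprod g (primesProdIco (uu D ε) z) ≤ MC hD hε g 1 z) ∧
    (PhiA (D := D) (ε := ε) g 0 z ≤ BetaSieve.vprod g (primesProdBelow (zT (D := D) (ε := ε) z)) ∧
      BetaSieve.vprod g (primesProdBelow (zT (D := D) (ε := ε) z)) ≤ PhiA (D := D) (ε := ε) g 1 z) ∧
    (GB (D := D) (ε := ε) g 0 z ≤ BetaSieve.vprod g (primesProdIco (w1 D ε) (zS (D := D) (ε := ε) z)) ∧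
      BetaSieve.vprod g (primesProdIco (w1 D ε) (zS (D := D) (ε := ε) z)) ≤ GB (D := D) (ε := ε) g 1 z) := by
  have hS : Squarefree (primesProdBelow (zS (D := D) (ε := ε) z)) := squarefree_primesProdBelow _
  have hC : Squarefree (primesProdIco (uu D ε) z) := squarefree_primesProdIco _ _
  have hT : Squarefree (primesProdBelow (zT (D := D) (ε := ε) z)) := squarefree_primesProdBelow _
  have hBsq : Squarefree (primesProdIco (w1 D ε) (zS (D := D) (ε := ε) z)) := squarefree_primesProdIco _ _
  refine ⟨⟨?_, ?_⟩, ⟨?_, ?_⟩, ⟨?_, ?_⟩, ⟨?_, ?_⟩⟩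
  · exact sum_le_vprod_of_lower hg hS (h01_of_primeFactors h01 _) fun n hn => (upper_lower_phi (zS_le_uu z) hn).2
  · exact vprod_le_sum_of_upper hg hS (h01_of_primeFactors h01 _) fun n hn => (upper_lower_phi (zS_le_uu z) hn).1
  · exact sum_le_vprod_of_lower hg hC (h01_of_primeFactors h01 _) fun n hn => BetaSieve.lower_sieveC (hC.squarefree_of_dvd hn)
  · exact vprod_le_sum_of_upper hg hC (h01_of_primeFactors h01 _) fun n hn => BetaSieve.upper_sieveC (hC.squarefree_of_dvd hn)
  · exact sum_le_vprod_of_lower hg hT (h01_of_primeFactors h01 _) fun n hn => BetaSieve.lower_sieve (hT.squarefree_of_dvd hn)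
  · exact vprod_le_sum_of_upper hg hT (h01_of_primeFactors h01 _) fun n hn => BetaSieve.upper_sieve (hT.squarefree_of_dvd hn)
  · exact sum_le_vprod_of_lower hg hBsq (h01_of_primeFactors h01 _) fun n hn => BetaSieve.lower_sieve (hBsq.squarefree_of_dvd hn)
  · exact vprod_le_sum_of_upper hg hBsq (h01_of_primeFactors h01 _) fun n hn => BetaSieve.upper_sieve (hBsq.squarefree_of_dvd hn)

/-- **The outer structural inequalities** (Iwaniec (27)–(29) with the swap of §5):
`∑_{d ∣ P(z)} Λ⁺_z(d) g(d) ≤ Φ⁺ M_C⁺ + (Φ⁺ − Φ⁻) W_C` and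
`∑_{d ∣ P(z)} Λ⁻_z(d) g(d) ≥ Φ⁻ M_C⁻ − (Φ⁺ − Φ⁻) W_C`. [cite: IwaniecActaArith1980b, §5 (27)–(29) p. 317] -/
theorem mainSum_LamZ_bounds (z : ℝ) :
    (∑ d ∈ (primesProdBelow z).divisors, LamZ hD hε 1 z d * g d ≤
        PhiS (D := D) (ε := ε) g 1 z * MC hD hε g 1 z +
          (PhiS (D := D) (ε := ε) g 1 z - PhiS (D := D) (ε := ε) g 0 z) * WC (D := D) (ε := ε) g z) ∧
    (PhiS (D := D) (ε := ε) g 0 z * MC hD hε g 0 z -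
          (PhiS (D := D) (ε := ε) g 1 z - PhiS (D := D) (ε := ε) g 0 z) * WC (D := D) (ε := ε) g z ≤
      ∑ d ∈ (primesProdBelow z).divisors, LamZ hD hε 0 z d * g d) := by
  set Pin := primesProdBelow (zS (D := D) (ε := ε) z) with hPin
  set Pout := primesProdIco (uu D ε) z with hPout
  have hPz : primesProdBelow z = Pin * Pout := primesProdBelow_eq_min_mul z
  have hcop : Nat.Coprime Pin Pout := coprime_min_Ico z
  have hPout_sq : Squarefree Pout := squarefree_primesProdIco _ _
  have hg0 : ∀ t ∈ Pout.divisors, 0 ≤ g t := fun t ht => g_nonneg_of_dvd h01 hPout_sq hg ht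
  have hΦ : PhiS (D := D) (ε := ε) g 0 z ≤ PhiS (D := D) (ε := ε) g 1 z :=
    (sandwiches hD hε hg h01 z).1.1.trans (sandwiches hD hε hg h01 z).1.2
  have hWC : ∀ par, ∑ t ∈ Pout.divisors, |lamC hD hε par t| * g t ≤ WC (D := D) (ε := ε) g z := by
    intro par
    refine Finset.sum_le_sum fun t ht => ?_
    exact mul_le_of_le_one_left (hg0 t ht) (abs_lamC_le_one hD hε par t)
  have hdiff : 0 ≤ PhiS (D := D) (ε := ε) g 1 z - PhiS (D := D) (ε := ε) g 0 z := by linarith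
  rw [hPz]
  constructor
  · have h := BetaSieve.mainSum_compSel_one_le (lam := lamC hD hε 1) (phiP := phi D ε 1) (phiM := phi D ε 0)
      hg hcop hg0 hΦ
    refine h.trans ?_
    change PhiS (D := D) (ε := ε) g 1 z * MC hD hε g 1 z +
      (PhiS (D := D) (ε := ε) g 1 z - PhiS (D := D) (ε := ε) g 0 z) * ∑ t ∈ Pout.divisors, |lamC hD hε 1 t| * g t ≤ _
    nlinarith [hWC 1]
  · have h := BetaSieve.le_mainSum_compSel_zero (lam := lamC hD hε 0) (phiP := phi D ε 1) (phiM := phi D ε 0)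
      hg hcop hg0 hΦ
    refine le_trans ?_ h
    change _ ≤ PhiS (D := D) (ε := ε) g 0 z * MC hD hε g 0 z -
      (PhiS (D := D) (ε := ε) g 1 z - PhiS (D := D) (ε := ε) g 0 z) * ∑ t ∈ Pout.divisors, |lamC hD hε 0 t| * g t
    nlinarith [hWC 0]

omit hD hε hg h01 in
/-- `P(y) = P(min y w₁) · P(y, w₁)`. [folklore] -/
theorem primesProdBelow_eq_min_w1_mul (y : ℝ) :
    primesProdBelow y = primesProdBelow (min y (w1 D ε)) * primesProdIco (w1 D ε) y := by
  rcases le_total y (w1 D ε) with hyw | hwy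
  · rw [min_eq_left hyw, primesProdIco_eq_one_of_le hyw, mul_one]
  · rw [min_eq_right hwy, primesProdBelow_mul_primesProdIco hwy]

/-- **The inner structural inequalities**: `Φ⁺(z') ≤ Φ_A⁺ G_B⁺ + (Φ_A⁺ − Φ_A⁻) W_B` and
`Φ⁻(z') ≥ Φ_A⁻ G_B⁻ − (Φ_A⁺ − Φ_A⁻) W_B`. [cite: IwaniecActaArith1980b, §5 p. 317 (first display)] -/
theorem PhiS_bounds (z : ℝ) :
    (PhiS (D := D) (ε := ε) g 1 z ≤ PhiA (D := D) (ε := ε) g 1 z * GB (D := D) (ε := ε) g 1 z +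
        (PhiA (D := D) (ε := ε) g 1 z - PhiA (D := D) (ε := ε) g 0 z) * WB (D := D) (ε := ε) g z) ∧
    (PhiA (D := D) (ε := ε) g 0 z * GB (D := D) (ε := ε) g 0 z -
          (PhiA (D := D) (ε := ε) g 1 z - PhiA (D := D) (ε := ε) g 0 z) * WB (D := D) (ε := ε) g z ≤
      PhiS (D := D) (ε := ε) g 0 z) := by
  set y := zS (D := D) (ε := ε) z with hy
  set w := w1 D ε with hw
  set Pin := primesProdBelow (min y w) with hPin
  set Pout := primesProdIco w y with hPout
  have hyu : y ≤ uu D ε := zS_le_uu z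
  have hPy : primesProdBelow y = Pin * Pout := primesProdBelow_eq_min_w1_mul y
  have hcop : Nat.Coprime Pin Pout :=
    Nat.Coprime.coprime_dvd_left (SieveSequence.primesProdBelow_dvd (min_le_right _ _))
      (coprime_primesProdBelow_primesProdIco w y)
  have hPout_sq : Squarefree Pout := squarefree_primesProdIco _ _
  have hg0 : ∀ t ∈ Pout.divisors, 0 ≤ g t := fun t ht => g_nonneg_of_dvd h01 hPout_sq hg ht
  have hzT : zT (D := D) (ε := ε) z = min y w := zT_eq_min_zS z
  -- `φ` on the divisors of `P(y)` is the composite over the truncated moduli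
  have hcongr : ∀ par, ∀ e ∈ (primesProdBelow y).divisors, phi D ε par e * g e =
      BetaSieve.compSel par (lamB D ε par) (lamA D ε 1) (lamA D ε 0) Pin Pout e * g e := by
    intro par e he
    have hey : e ∣ primesProdBelow y := Nat.dvd_of_mem_divisors he
    have heu : e ∣ primesProdBelow (uu D ε) := hey.trans (SieveSequence.primesProdBelow_dvd hyu)
    congr 1
    unfold phi
    rw [if_pos heu]
    refine BetaSieve.compSel_congr ?_ ?_
    · rw [hPin]
      rcases le_total y w with hyw' | hwy
      · rw [min_eq_left hyw', gcd_primesProdBelow_eq_of_dvd hey hyw']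
      · rw [min_eq_right hwy]
    · exact gcd_primesProdIco_eq_of_dvd hey hyu
  have hΦA : PhiA (D := D) (ε := ε) g 0 z ≤ PhiA (D := D) (ε := ε) g 1 z :=
    (sandwiches hD hε hg h01 z).2.2.1.1.trans (sandwiches hD hε hg h01 z).2.2.1.2
  have hdiff : 0 ≤ PhiA (D := D) (ε := ε) g 1 z - PhiA (D := D) (ε := ε) g 0 z := by linarith
  have hA_eq : ∀ par, ∑ e ∈ Pin.divisors, lamA D ε par e * g e = PhiA (D := D) (ε := ε) g par z := by
    intro par; rw [PhiA, hzT, BetaSieve.mainSum]; rfl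
  have hB_eq : ∀ par, ∑ t ∈ Pout.divisors, lamB D ε par t * g t = GB (D := D) (ε := ε) g par z := by
    intro par; rw [GB, BetaSieve.mainSum]; rfl
  have hWB : ∀ par, ∑ t ∈ Pout.divisors, |lamB D ε par t| * g t ≤ WB (D := D) (ε := ε) g z := by
    intro par
    refine Finset.sum_le_sum fun t ht => ?_
    exact mul_le_of_le_one_left (hg0 t ht) (abs_lamB_le_one par t)
  have hΦA' : ∑ e ∈ Pin.divisors, lamA D ε 0 e * g e ≤ ∑ e ∈ Pin.divisors, lamA D ε 1 e * g e := by
    rw [hA_eq, hA_eq]; exact hΦA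
  constructor
  · rw [PhiS, ← hy, Finset.sum_congr rfl (hcongr 1), hPy]
    have h := BetaSieve.mainSum_compSel_one_le (lam := lamB D ε 1) (phiP := lamA D ε 1) (phiM := lamA D ε 0)
      hg hcop hg0 hΦA'
    refine h.trans ?_
    rw [hA_eq, hA_eq, hB_eq]
    nlinarith [hWB 1]
  · rw [PhiS, ← hy, Finset.sum_congr rfl (hcongr 0), hPy]
    have h := BetaSieve.le_mainSum_compSel_zero (lam := lamB D ε 0) (phiP := lamA D ε 1) (phiM := lamA D ε 0)
      hg hcop hg0 hΦA'
    refine le_trans ?_ h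
    rw [hA_eq, hA_eq, hB_eq]
    nlinarith [hWB 0]

omit hD hε in
/-- `W_C ≤ V(z,u)⁻¹` and `W_B ≤ V(z',w₁)⁻¹`. [cite: IwaniecActaArith1980b, §5 p. 319] -/
theorem WC_WB_le (z : ℝ) :
    WC (D := D) (ε := ε) g z ≤ (BetaSieve.vprod g (primesProdIco (uu D ε) z))⁻¹ ∧
      WB (D := D) (ε := ε) g z ≤ (BetaSieve.vprod g (primesProdIco (w1 D ε) (zS (D := D) (ε := ε) z)))⁻¹ :=
  ⟨sum_divisors_Ico_le hg h01 _ _, sum_divisors_Ico_le hg h01 _ _⟩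

/-- **The crude bound**: `|∑_{d ∣ P(z)} Λ_z(d) g(d)| ≤ ∑_{d ∣ P(z)} g(d) ≤ V(z)⁻¹`. [folklore] -/
theorem abs_mainSum_LamZ_le (par : ℕ) (z : ℝ) :
    |∑ d ∈ (primesProdBelow z).divisors, LamZ hD hε par z d * g d| ≤ (BetaSieve.vprod g (primesProdBelow z))⁻¹ := by
  have hP : Squarefree (primesProdBelow z) := squarefree_primesProdBelow z
  refine (Finset.abs_sum_le_sum_abs _ _).trans ?_
  refine le_trans (Finset.sum_le_sum fun d hd => ?_)
    (BetaSieve.sum_divisors_le_vprod_inv hg hP fun p hp => h01 p (Nat.prime_of_mem_primeFactors hp))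
  rw [abs_mul, abs_of_nonneg (g_nonneg_of_dvd h01 hP hg hd)]
  exact mul_le_of_le_one_left (g_nonneg_of_dvd h01 hP hg hd) (abs_LamZ_le_one hD hε par z d)

end MainTerm

end Weights

end Core

end Iwaniec1980b

end Literature.NumberTheory.Sieve

end
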